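import Mathlib
import Summits.NavierStokesRegularity.NavierStokesRegularity.Theorems.HeteroclinicTriggerChainTriggerChainFrontStepJunkRow
import HarnessLib

/-!
# `HeteroclinicTriggerChain` — crux `TriggerChainFrontStep` (item stmt-NavierStokesRegularity-22785):
  the JUNK ENVELOPE — damped forced junk modes of an exact lattice flow grow at most linearly

Envelope supply for the lattice hop lemmas (`…LatticeDelay/Capture/Seed` take the junk envelope `ι` as an
input). By `…JunkRow`, a junk mode `p = S_{j,n}` (`j ∉ {i₀,i₁}`) of an exact flow of `α₀ + βσ` obeys
`p′ = c(t)·p + src(t)` with the carrier coupling `c = 2^{5n/2}(d_j x_n − g_j x_{n+1}) ≤ 0` (DAMPING, as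
long as the carriers are nonnegative: `d_j ≤ 0` by the saddle clause, `g_j ≥ 0`) and a source made of the
trigger self-interaction `b_j u_n²`, `b′_j u_{n−1}²` (zero on the junk-free class), the overlap triad
`(λ¹+λ²) u_{n+1}u_n`, the junk × junk blocks and the `σ`-row. Two statements:

* `htcJE_dampedForcedOn_abs_le` — scalar: `p′ = c·p + src`, `c ≤ 0`, `|src| ≤ s₀` on `[0,T]` (within
  the segment) ⇒ `|p(t)| ≤ |p(0)| + s₀·t` (no amplification);
* `htcJE_junk_envelope` — lattice: with envelopes `M ≥ |S_{i₁,n}|`, `U ≥ |S_{i₁,n+1}|`, `ω ≥ |S_{i₁,n−1}|`,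
  `ι̂ ≥` all junk amplitudes at shells `n−1, n, n+1` (bootstrap input), `B_σ ≥ |σ-row (j,n)|`, and
  nonnegative carriers `S_{i₀,n}, S_{i₀,n+1} ≥ 0` on the window:
  `|S_{j,n}(t)| ≤ |S_{j,n}(0)| + s₀·t`,
  `s₀ = 2^{5n/2}(|b_j|M² + 2MU + 48ι̂²) + 2^{5(n−1)/2}(|b′_j|ω² + 16ι̂²) + βB_σ`.

HONEST FRAMING: statements about exact flows of Tao-type MODEL lattices (Tao 2016 §4) under envelope
hypotheses; helper for the crux (no stub credit); nothing here is a statement about the Navier–Stokes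
equations; no summit, rung or crux is proved.
-/

noncomputable section

set_option linter.dupNamespace false

open Real Set

namespace Summit.NavierStokesRegularity.NavierStokesRegularity.Theorems

open Literature.Analysis.FluidPDE Literature.Analysis.FluidPDE.TaoCascade

/-- **Damped forced scalar equation, no amplification.** If on `[0,T]` (derivatives within the segment)
`p′ = c·p + src` with `c ≤ 0` and `|src| ≤ s₀`, then `|p(t)| ≤ |p(0)| + s₀·t` for `t ∈ [0,T]` (fence for
`p²` against `(|p(0)| + ε + (s₀+ε)t)²`, then `ε → 0`). [folklore] -/
theorem htcJE_dampedForcedOn_abs_le {T s₀ : ℝ} {p c src : ℝ → ℝ}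
    (hp : ∀ t ∈ Icc 0 T, HasDerivWithinAt p (c t * p t + src t) (Icc 0 T) t)
    (hc : ∀ t ∈ Icc 0 T, c t ≤ 0) (hsrc : ∀ t ∈ Icc 0 T, |src t| ≤ s₀) :
    ∀ t ∈ Icc 0 T, |p t| ≤ |p 0| + s₀ * t := by
  intro t ht
  rcases lt_or_ge T 0 with hT | hT
  · exact absurd (ht.1.trans ht.2) (not_le.2 hT)
  have hs0 : 0 ≤ s₀ := (abs_nonneg _).trans (hsrc 0 ⟨le_rfl, hT⟩)
  have hW : ∀ r ∈ Icc 0 T, HasDerivWithinAt (fun r => p r ^ 2) (2 * p r * (c r * p r + src r)) (Icc 0 T) r := by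
    intro r hr
    have h := (hp r hr).pow 2
    refine h.congr_deriv ?_
    push_cast; ring
  have hWc : ContinuousOn (fun r => p r ^ 2) (Icc 0 T) := fun r hr => (hW r hr).continuousWithinAt
  have hW' : ∀ r ∈ Ico 0 T, HasDerivWithinAt (fun r => p r ^ 2) (2 * p r * (c r * p r + src r)) (Ici r) r :=
    fun r hr => (hW r (Ico_subset_Icc_self hr)).mono_of_mem_nhdsWithin (Icc_mem_nhdsGE_of_mem hr)
  have hmain : ∀ ε : ℝ, 0 < ε → p t ^ 2 ≤ (|p 0| + ε + (s₀ + ε) * t) ^ 2 := by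
    intro ε hε
    have hBd : ∀ r, HasDerivAt (fun r => (|p 0| + ε + (s₀ + ε) * r) ^ 2)
        (2 * (|p 0| + ε + (s₀ + ε) * r) * (s₀ + ε)) r := by
      intro r
      have h := (((hasDerivAt_id r).const_mul (s₀ + ε)).const_add (|p 0| + ε)).pow 2
      refine h.congr_deriv ?_
      push_cast; simp only [id, mul_one]; ring
    refine image_le_of_deriv_right_lt_deriv_boundary (f := fun r => p r ^ 2) (a := 0) (b := T)
      hWc hW' ?_ hBd ?_ ht
    · simp only [mul_zero, add_zero]
      have h0 : |p 0| ≤ |p 0| + ε := by linarith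
      calc p 0 ^ 2 = |p 0| ^ 2 := (sq_abs _).symm
        _ ≤ (|p 0| + ε) ^ 2 := pow_le_pow_left₀ (abs_nonneg _) h0 2
    · intro r hr hcontact
      have hr' := Ico_subset_Icc_self hr
      set B : ℝ := |p 0| + ε + (s₀ + ε) * r with hB
      have hBp : 0 < B := by
        have : 0 ≤ (s₀ + ε) * r := mul_nonneg (by linarith) hr.1
        have := abs_nonneg (p 0); linarith
      have habs : |p r| = B := by
        have h1 : |p r| ^ 2 = B ^ 2 := by rw [sq_abs]; exact hcontact
        nlinarith [abs_nonneg (p r), sq_nonneg (|p r| - B), sq_nonneg (|p r| + B)]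
      have h1 : 2 * p r * (c r * p r + src r) = 2 * c r * p r ^ 2 + 2 * (p r * src r) := by ring
      have h2 : 2 * c r * p r ^ 2 ≤ 0 :=
        mul_nonpos_of_nonpos_of_nonneg (by linarith [hc r hr']) (sq_nonneg _)
      have h3 : p r * src r ≤ |p r| * s₀ := by
        calc p r * src r ≤ |p r * src r| := le_abs_self _
          _ = |p r| * |src r| := abs_mul _ _
          _ ≤ |p r| * s₀ := mul_le_mul_of_nonneg_left (hsrc r hr') (abs_nonneg _)
      rw [h1, habs] at *
      have : 2 * B * s₀ < 2 * B * (s₀ + ε) := by nlinarith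
      linarith
  have hroot : ∀ ε : ℝ, 0 < ε → |p t| ≤ |p 0| + ε + (s₀ + ε) * t := by
    intro ε hε
    have hBp : 0 ≤ |p 0| + ε + (s₀ + ε) * t := by
      have : 0 ≤ (s₀ + ε) * t := mul_nonneg (by linarith) ht.1
      have := abs_nonneg (p 0); linarith
    have h := sq_le_sq.1 (hmain ε hε)
    rwa [abs_of_nonneg hBp] at h
  refine le_of_forall_pos_le_add fun δ hδ => ?_
  have h := hroot (δ / (1 + t)) (div_pos hδ (by linarith [ht.1]))
  have key : δ / (1 + t) * (1 + t) = δ := div_mul_cancel₀ _ (by linarith [ht.1])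
  calc |p t| ≤ |p 0| + δ / (1 + t) + (s₀ + δ / (1 + t)) * t := h
    _ = |p 0| + s₀ * t + δ / (1 + t) * (1 + t) := by ring
    _ = |p 0| + s₀ * t + δ := by rw [key]

/-- **JUNK ENVELOPE ON THE LATTICE.** Setting of the module docstring: an exact flow `S` of `α₀ + βσ` on
`[0,T]` (`α₀` in normal form at `i₀`, parity at `i₁`, `|α₀| ≤ 1`), a junk mode `j ∉ {i₀,i₁}` at shell `n`
with `d j 0 ≤ 0 ≤ g_j` and nonnegative carriers `S_{i₀,n}, S_{i₀,n+1}` on the window, envelopes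
`M, U, ω` (triggers at `n, n+1, n−1`), `ι̂` (all junk at `n−1,n,n+1`), `B_σ` (the `σ`-row `(j,n)`). Then
`|S_{j,n}(t)| ≤ |S_{j,n}(0)| + s₀·t` with
`s₀ = 2^{5n/2}(|b_j|M² + 2MU + 48ι̂²) + 2^{5(n−1)/2}(|b′_j|ω² + 16ι̂²) + βB_σ`,
`b_j = α₀ i₁ i₁ j (0,0,0)`, `b′_j = α₀ i₁ i₁ j (0,0,1)`. [this file] -/
theorem htcJE_junk_envelope (α₀ σ : Fin 4 → Fin 4 → Fin 4 → ℤ × ℤ × ℤ → ℝ) (i₀ i₁ j : Fin 4)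
    (d : Fin 4 → ℤ → ℝ) (hne : i₀ ≠ i₁) (hj0 : j ≠ i₀) (hj1 : j ≠ i₁)
    (hsym : IsSymmetricCoeff α₀) (hcanc : IsCancellingCoeff α₀)
    (hpure : ∀ X : Fin 4 → ℤ → ℝ → ℝ, (∀ i n t, i ≠ i₀ → X i n t = 0) →
      ∀ i n t, quadTerm 1 α₀ X i n t = 0)
    (hsad : ∀ (Y : Fin 4 → ℤ → ℝ → ℝ) (i : Fin 4) (n : ℤ) (t : ℝ),
      quadTerm 1 α₀ (fun j m s => (fun j m (_ : ℝ) => if j = i₀ ∧ m = 0 then (1 : ℝ) else 0) j m s +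
          Y j m s) i n t -
        quadTerm 1 α₀ (fun j m (_ : ℝ) => if j = i₀ ∧ m = 0 then (1 : ℝ) else 0) i n t -
        quadTerm 1 α₀ Y i n t = d i n * Y i n t)
    (hpar : ∀ (j₁ j₂ j₃ : Fin 4) (μ : ℤ × ℤ × ℤ),
      Xor (Xor (j₁ = i₁) (j₂ = i₁)) (j₃ = i₁) → α₀ j₁ j₂ j₃ μ = 0)
    (hα1 : ∀ a b c μ, |α₀ a b c μ| ≤ 1)
    (β : ℝ) (hβ : 0 ≤ β) (S : Fin 4 → ℤ → ℝ → ℝ) {T : ℝ} (n : ℤ)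
    (hS : ∀ i k, ∀ t ∈ Icc 0 T, HasDerivWithinAt (S i k)
      (quadTerm 1 α₀ S i k t + β * quadTerm 1 σ S i k t) (Icc 0 T) t)
    (hdj : d j 0 ≤ 0) (hgj : 0 ≤ α₀ j j i₀ (0, 0, 1))
    (hx : ∀ t ∈ Icc 0 T, 0 ≤ S i₀ n t ∧ 0 ≤ S i₀ (n + 1) t)
    {M U ω ι B : ℝ} (hι0 : 0 ≤ ι)
    (hMu : ∀ t ∈ Icc 0 T, |S i₁ n t| ≤ M) (hU : ∀ t ∈ Icc 0 T, |S i₁ (n + 1) t| ≤ U)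
    (hω : ∀ t ∈ Icc 0 T, |S i₁ (n - 1) t| ≤ ω)
    (hι : ∀ t ∈ Icc 0 T, ∀ a, a ≠ i₀ → a ≠ i₁ →
      |S a n t| ≤ ι ∧ |S a (n + 1) t| ≤ ι ∧ |S a (n - 1) t| ≤ ι)
    (hB : ∀ t ∈ Icc 0 T, |quadTerm 1 σ S j n t| ≤ B) :
    ∀ t ∈ Icc 0 T, |S j n t| ≤ |S j n 0| +
      ((1 + 1 : ℝ) ^ ((5 : ℝ) * n / 2) * (|α₀ i₁ i₁ j (0, 0, 0)| * M ^ 2 + 2 * M * U + 48 * ι ^ 2) +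
        (1 + 1 : ℝ) ^ ((5 : ℝ) * ((n : ℝ) - 1) / 2) * (|α₀ i₁ i₁ j (0, 0, 1)| * ω ^ 2 + 16 * ι ^ 2) +
        β * B) * t := by
  set γ₀ : ℝ := (1 + 1 : ℝ) ^ ((5 : ℝ) * n / 2) with hγ₀
  set γ₁ : ℝ := (1 + 1 : ℝ) ^ ((5 : ℝ) * ((n : ℝ) - 1) / 2) with hγ₁
  have hγ₀0 : 0 ≤ γ₀ := Real.rpow_nonneg (by norm_num) _
  have hγ₁0 : 0 ≤ γ₁ := Real.rpow_nonneg (by norm_num) _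
  -- the junk row, split as damping + source
  refine htcJE_dampedForcedOn_abs_le (p := S j n)
    (c := fun t => γ₀ * (d j 0 * S i₀ n t - α₀ j j i₀ (0, 0, 1) * S i₀ (n + 1) t))
    (src := fun t => (quadTerm 1 α₀ S j n t + β * quadTerm 1 σ S j n t) -
      γ₀ * (d j 0 * S i₀ n t - α₀ j j i₀ (0, 0, 1) * S i₀ (n + 1) t) * S j n t)
    (fun t ht => (hS j n t ht).congr_deriv (by ring)) (fun t ht => ?_) (fun t ht => ?_)
  · -- damping
    have h1 : d j 0 * S i₀ n t ≤ 0 := mul_nonpos_of_nonpos_of_nonneg hdj (hx t ht).1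
    have h2 : 0 ≤ α₀ j j i₀ (0, 0, 1) * S i₀ (n + 1) t := mul_nonneg hgj (hx t ht).2
    exact mul_nonpos_of_nonneg_of_nonpos hγ₀0 (by linarith)
  · -- source bound
    have hrow := htcJR_quadTerm_junk α₀ i₀ i₁ j d hne hj0 hj1 hsym hcanc hpure hsad hpar S n t
    have hjn : ∀ a, a ≠ i₀ → a ≠ i₁ → |S a n t| ≤ ι := fun a h0 h1 => (hι t ht a h0 h1).1
    have hjp : ∀ a, a ≠ i₀ → a ≠ i₁ → |S a (n + 1) t| ≤ ι := fun a h0 h1 => (hι t ht a h0 h1).2.1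
    have hjm : ∀ a, a ≠ i₀ → a ≠ i₁ → |S a (n - 1) t| ≤ ι := fun a h0 h1 => (hι t ht a h0 h1).2.2
    -- the junk × junk blocks
    have hprod : ∀ (c y z : ℝ), |c| ≤ 1 → |y| ≤ ι → |z| ≤ ι → |c * (y * z)| ≤ ι ^ 2 :=
      fun c y z hc hy hz => by
        rw [abs_mul, abs_mul]
        have := mul_le_mul hy hz (abs_nonneg _) hι0
        calc |c| * (|y| * |z|) ≤ 1 * (ι * ι) :=
            mul_le_mul hc this (mul_nonneg (abs_nonneg _) (abs_nonneg _)) (by norm_num)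
          _ = ι ^ 2 := by ring
    have hJJ0 := htcJR_junkBlock_abs_le
      (fun a b => α₀ a b j (0, 0, 0) * (S a n t * S b n t) +
        α₀ a b j (1, 0, 0) * (S a (n + 1) t * S b n t) + α₀ a b j (0, 1, 0) * (S a n t * S b (n + 1) t))
      (i₀ := i₀) (i₁ := i₁) (B := 3 * ι ^ 2) (by positivity)
      (fun a b ha0 ha1 hb0 hb1 => by
        calc _ ≤ |α₀ a b j (0, 0, 0) * (S a n t * S b n t) + α₀ a b j (1, 0, 0) * (S a (n + 1) t * S b n t)|
              + |α₀ a b j (0, 1, 0) * (S a n t * S b (n + 1) t)| := abs_add_le _ _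
          _ ≤ |α₀ a b j (0, 0, 0) * (S a n t * S b n t)| + |α₀ a b j (1, 0, 0) * (S a (n + 1) t * S b n t)|
              + |α₀ a b j (0, 1, 0) * (S a n t * S b (n + 1) t)| := by
                linarith [abs_add_le (α₀ a b j (0, 0, 0) * (S a n t * S b n t))
                  (α₀ a b j (1, 0, 0) * (S a (n + 1) t * S b n t))]
          _ ≤ ι ^ 2 + ι ^ 2 + ι ^ 2 := by
              linarith [hprod _ _ _ (hα1 a b j (0, 0, 0)) (hjn a ha0 ha1) (hjn b hb0 hb1),
                hprod _ _ _ (hα1 a b j (1, 0, 0)) (hjp a ha0 ha1) (hjn b hb0 hb1),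
                hprod _ _ _ (hα1 a b j (0, 1, 0)) (hjn a ha0 ha1) (hjp b hb0 hb1)]
          _ = 3 * ι ^ 2 := by ring)
    have hJJ1 := htcJR_junkBlock_abs_le
      (fun a b => α₀ a b j (0, 0, 1) * (S a (n - 1) t * S b (n - 1) t))
      (i₀ := i₀) (i₁ := i₁) (B := ι ^ 2) (by positivity)
      (fun a b ha0 ha1 hb0 hb1 => hprod _ _ _ (hα1 a b j (0, 0, 1)) (hjm a ha0 ha1) (hjm b hb0 hb1))
    -- the trigger sources
    have hM0 : 0 ≤ M := (abs_nonneg _).trans (hMu t ht)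
    have hu2 : S i₁ n t ^ 2 ≤ M ^ 2 := by
      have := hMu t ht; have := abs_nonneg (S i₁ n t); nlinarith [sq_abs (S i₁ n t)]
    have hw2 : S i₁ (n - 1) t ^ 2 ≤ ω ^ 2 := by
      have := hω t ht; have := abs_nonneg (S i₁ (n - 1) t); nlinarith [sq_abs (S i₁ (n - 1) t)]
    have hs1 : |α₀ i₁ i₁ j (0, 0, 0) * S i₁ n t ^ 2| ≤ |α₀ i₁ i₁ j (0, 0, 0)| * M ^ 2 := by
      rw [abs_mul, abs_of_nonneg (sq_nonneg (S i₁ n t))]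
      exact mul_le_mul_of_nonneg_left hu2 (abs_nonneg _)
    have hs2 : |(α₀ i₁ i₁ j (1, 0, 0) + α₀ i₁ i₁ j (0, 1, 0)) * (S i₁ (n + 1) t * S i₁ n t)| ≤ 2 * M * U := by
      rw [abs_mul, abs_mul]
      have hl : |α₀ i₁ i₁ j (1, 0, 0) + α₀ i₁ i₁ j (0, 1, 0)| ≤ 2 := by
        calc _ ≤ |α₀ i₁ i₁ j (1, 0, 0)| + |α₀ i₁ i₁ j (0, 1, 0)| := abs_add_le _ _
          _ ≤ 2 := by linarith [hα1 i₁ i₁ j (1, 0, 0), hα1 i₁ i₁ j (0, 1, 0)]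
      have hp : |S i₁ (n + 1) t| * |S i₁ n t| ≤ U * M :=
        mul_le_mul (hU t ht) (hMu t ht) (abs_nonneg _) ((abs_nonneg _).trans (hU t ht))
      calc |α₀ i₁ i₁ j (1, 0, 0) + α₀ i₁ i₁ j (0, 1, 0)| * (|S i₁ (n + 1) t| * |S i₁ n t|)
          ≤ 2 * (U * M) := mul_le_mul hl hp (mul_nonneg (abs_nonneg _) (abs_nonneg _)) (by norm_num)
        _ = 2 * M * U := by ring
    have hs3 : |α₀ i₁ i₁ j (0, 0, 1) * S i₁ (n - 1) t ^ 2| ≤ |α₀ i₁ i₁ j (0, 0, 1)| * ω ^ 2 := by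
      rw [abs_mul, abs_of_nonneg (sq_nonneg (S i₁ (n - 1) t))]
      exact mul_le_mul_of_nonneg_left hw2 (abs_nonneg _)
    have hsσ : |β * quadTerm 1 σ S j n t| ≤ β * B := by
      rw [abs_mul, abs_of_nonneg hβ]; exact mul_le_mul_of_nonneg_left (hB t ht) hβ
    -- the source in closed form
    have heq : (quadTerm 1 α₀ S j n t + β * quadTerm 1 σ S j n t) -
        γ₀ * (d j 0 * S i₀ n t - α₀ j j i₀ (0, 0, 1) * S i₀ (n + 1) t) * S j n t =
        γ₀ * (α₀ i₁ i₁ j (0, 0, 0) * S i₁ n t ^ 2 +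
          (α₀ i₁ i₁ j (1, 0, 0) + α₀ i₁ i₁ j (0, 1, 0)) * (S i₁ (n + 1) t * S i₁ n t) +
          ∑ a, ∑ b, (if (a ≠ i₀ ∧ a ≠ i₁) ∧ (b ≠ i₀ ∧ b ≠ i₁) then
            α₀ a b j (0, 0, 0) * (S a n t * S b n t) + α₀ a b j (1, 0, 0) * (S a (n + 1) t * S b n t) +
              α₀ a b j (0, 1, 0) * (S a n t * S b (n + 1) t) else 0)) +
        γ₁ * (α₀ i₁ i₁ j (0, 0, 1) * S i₁ (n - 1) t ^ 2 +
          ∑ a, ∑ b, (if (a ≠ i₀ ∧ a ≠ i₁) ∧ (b ≠ i₀ ∧ b ≠ i₁) then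
            α₀ a b j (0, 0, 1) * (S a (n - 1) t * S b (n - 1) t) else 0)) +
        β * quadTerm 1 σ S j n t := by
      rw [hrow]; ring
    show |(quadTerm 1 α₀ S j n t + β * quadTerm 1 σ S j n t) -
        γ₀ * (d j 0 * S i₀ n t - α₀ j j i₀ (0, 0, 1) * S i₀ (n + 1) t) * S j n t| ≤ _
    rw [heq]
    -- assemble
    set J0 := ∑ a, ∑ b, (if (a ≠ i₀ ∧ a ≠ i₁) ∧ (b ≠ i₀ ∧ b ≠ i₁) then
      α₀ a b j (0, 0, 0) * (S a n t * S b n t) + α₀ a b j (1, 0, 0) * (S a (n + 1) t * S b n t) +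
        α₀ a b j (0, 1, 0) * (S a n t * S b (n + 1) t) else 0) with hJ0
    set J1 := ∑ a, ∑ b, (if (a ≠ i₀ ∧ a ≠ i₁) ∧ (b ≠ i₀ ∧ b ≠ i₁) then
      α₀ a b j (0, 0, 1) * (S a (n - 1) t * S b (n - 1) t) else 0) with hJ1
    have hA : |α₀ i₁ i₁ j (0, 0, 0) * S i₁ n t ^ 2 +
        (α₀ i₁ i₁ j (1, 0, 0) + α₀ i₁ i₁ j (0, 1, 0)) * (S i₁ (n + 1) t * S i₁ n t) + J0| ≤
        |α₀ i₁ i₁ j (0, 0, 0)| * M ^ 2 + 2 * M * U + 48 * ι ^ 2 := by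
      calc _ ≤ |α₀ i₁ i₁ j (0, 0, 0) * S i₁ n t ^ 2 +
            (α₀ i₁ i₁ j (1, 0, 0) + α₀ i₁ i₁ j (0, 1, 0)) * (S i₁ (n + 1) t * S i₁ n t)| + |J0| :=
            abs_add_le _ _
        _ ≤ |α₀ i₁ i₁ j (0, 0, 0) * S i₁ n t ^ 2| +
            |(α₀ i₁ i₁ j (1, 0, 0) + α₀ i₁ i₁ j (0, 1, 0)) * (S i₁ (n + 1) t * S i₁ n t)| + |J0| := by
            linarith [abs_add_le (α₀ i₁ i₁ j (0, 0, 0) * S i₁ n t ^ 2)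
              ((α₀ i₁ i₁ j (1, 0, 0) + α₀ i₁ i₁ j (0, 1, 0)) * (S i₁ (n + 1) t * S i₁ n t))]
        _ ≤ _ := by linarith
    have hBterm : |α₀ i₁ i₁ j (0, 0, 1) * S i₁ (n - 1) t ^ 2 + J1| ≤
        |α₀ i₁ i₁ j (0, 0, 1)| * ω ^ 2 + 16 * ι ^ 2 := by
      calc _ ≤ |α₀ i₁ i₁ j (0, 0, 1) * S i₁ (n - 1) t ^ 2| + |J1| := abs_add_le _ _
        _ ≤ _ := by linarith
    have h1 : |γ₀ * (α₀ i₁ i₁ j (0, 0, 0) * S i₁ n t ^ 2 +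
        (α₀ i₁ i₁ j (1, 0, 0) + α₀ i₁ i₁ j (0, 1, 0)) * (S i₁ (n + 1) t * S i₁ n t) + J0)| ≤
        γ₀ * (|α₀ i₁ i₁ j (0, 0, 0)| * M ^ 2 + 2 * M * U + 48 * ι ^ 2) := by
      rw [abs_mul, abs_of_nonneg hγ₀0]; exact mul_le_mul_of_nonneg_left hA hγ₀0
    have h2 : |γ₁ * (α₀ i₁ i₁ j (0, 0, 1) * S i₁ (n - 1) t ^ 2 + J1)| ≤
        γ₁ * (|α₀ i₁ i₁ j (0, 0, 1)| * ω ^ 2 + 16 * ι ^ 2) := by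
      rw [abs_mul, abs_of_nonneg hγ₁0]; exact mul_le_mul_of_nonneg_left hBterm hγ₁0
    calc _ ≤ |γ₀ * (α₀ i₁ i₁ j (0, 0, 0) * S i₁ n t ^ 2 +
          (α₀ i₁ i₁ j (1, 0, 0) + α₀ i₁ i₁ j (0, 1, 0)) * (S i₁ (n + 1) t * S i₁ n t) + J0) +
          γ₁ * (α₀ i₁ i₁ j (0, 0, 1) * S i₁ (n - 1) t ^ 2 + J1)| + |β * quadTerm 1 σ S j n t| :=
          abs_add_le _ _
      _ ≤ |γ₀ * (α₀ i₁ i₁ j (0, 0, 0) * S i₁ n t ^ 2 +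
          (α₀ i₁ i₁ j (1, 0, 0) + α₀ i₁ i₁ j (0, 1, 0)) * (S i₁ (n + 1) t * S i₁ n t) + J0)| +
          |γ₁ * (α₀ i₁ i₁ j (0, 0, 1) * S i₁ (n - 1) t ^ 2 + J1)| + |β * quadTerm 1 σ S j n t| := by
          linarith [abs_add_le (γ₀ * (α₀ i₁ i₁ j (0, 0, 0) * S i₁ n t ^ 2 +
            (α₀ i₁ i₁ j (1, 0, 0) + α₀ i₁ i₁ j (0, 1, 0)) * (S i₁ (n + 1) t * S i₁ n t) + J0))
            (γ₁ * (α₀ i₁ i₁ j (0, 0, 1) * S i₁ (n - 1) t ^ 2 + J1))]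
      _ ≤ _ := by linarith

end Summit.NavierStokesRegularity.NavierStokesRegularity.Theorems

end
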